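import Summits.SmoothPoincare4.SmoothPoincare4.Theses.EntropyRung
import Summits.SmoothPoincare4.SmoothPoincare4.Theses.RicciFat
import Summits.SmoothPoincare4.SmoothPoincare4.Theorems.EntropyRungSubcylindricalExistenceStaticLinearHeat
import Summits.SmoothPoincare4.SmoothPoincare4.Theorems.EntropyRungSubcylindricalExistenceDimensionalFisher
import Summits.SmoothPoincare4.SmoothPoincare4.Theorems.EntropyRungSubcylindricalExistenceEntropyEnergyAlongFlow
import Summits.SmoothPoincare4.SmoothPoincare4.Theorems.EntropyRungSubcylindricalExistenceEntropyEnergyPositive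
import Summits.SmoothPoincare4.SmoothPoincare4.Theorems.EntropyRungSubcylindricalExistenceEntropyEnergyOfPositive
import Summits.SmoothPoincare4.SmoothPoincare4.Theorems.EntropyRungSubcylindricalExistenceEntropyVolume
import Literature.Geometry.Lorentzian.VolumeProofs
import Literature.Topology.FourManifolds.HomotopyS4CompactProofs
import Literature.Geometry.Riemannian.RoundSphereProofs
import Literature.Geometry.Riemannian.RoundSphereVolume
import Summits.SmoothPoincare4.SmoothPoincare4.Theorems.SubcylindricalExistence.Negative.Window
import HarnessLib

/-!
# Theorem A of line `curvature-dimension-entropy-floor` (crux `EntropyRung.SubcylindricalExistence`,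
item stmt-SmoothPoincare4-10871): the entropy–energy inequality EE(3,4), entropy ≥ log-volume under
`Ric ≥ 3g`, RoundBound, and ENT from a Ricci-fat metric at the fixed threshold `√(πe)/3`

This file assembles the six LANDED stubs of the line (`stub_staticLinearHeat`,
`stub_dimensionalFisher`, `stub_entropyEnergy_alongFlow`, `stub_entropyEnergy_positive`,
`stub_entropyEnergy_of_positive`, `stub_entropyVolume_of_entropyEnergy`) into the line's
UNCONDITIONAL theorems and its transfer:

* `entropyEnergyCD34` — **EE(3,4)** (Bakry–Gentil–Ledoux 2014 §6; Bakry–Bolley–Gentil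
  arXiv:1412.5165 eq. (4.1), case `ρ = 3`, `n = 4`): on a closed connected Riemannian 4-manifold with
  `Ric ≥ 3g`, for every smooth `w` with `∫ w² dV = Vol`,
  `(1/Vol) ∫ w² log w² dV ≤ 2 log(1 + ∫ |∇w|² dV/(3 Vol))` — proved along the heat flow by the
  DIMENSIONAL Bakry–Émery argument (static linear heat Cauchy problem, now a tree theorem:
  `Literature.Geometry.Riemannian.exists_staticLinearHeat`).
* `entropyVolumeComparison` — **Theorem A**: `Ric ≥ 3g`, `τ > 0`, `∫ (4πτ)⁻² e^{-f} dV = 1` ⇒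
  `log Vol − 2 log(2π/3) − 2 ≤ 𝒲(g,f,τ)`, i.e. `ν(g) ≥ ν(S⁴_rd) + log(Vol/Vol S⁴)`.
* `roundBound` — **RoundBound** (lower half of `ν(S⁴_round) = log 6 − 2`, Cao–Hamilton–Ilmanen
  2004, Thm 3.4, here WITHOUT Perelman monotonicity): `Ric ≥ 3g`, `Vol = 8π²/3` ⇒
  `log 6 − 2 ≤ 𝒲(g,f,τ)` for every `τ > 0`.
* `subcylindricalExistence_of_ricciFatMetric` — **the transfer**: the crux ENT follows from
  Statement D of the line (`RicciFatMetric`: every closed smooth `M ≃ₕ S⁴` carries `g` with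
  `Ric ≥ 3g` and `Vol > (√π e^{1/2}/3)(8π²/3) = 25.637`), the ONLY open (SPC4-hard) stub.
* `subcylindricalExistence_of_ricciFatSphere` — **cross-route edge**: route RicciFat's crux
  `RicciFatSphere` (stmt-SmoothPoincare4-5192, `∀ δ > 0`) implies ENT (take `δ = 1/50 < 1 − √(πe)/3`).
* `roundSphereFour_wEntropy_ge`, `subcylindricalClause_roundSphereFour`, `ricciFatMetric_roundSphereFour`
  — the round `S⁴`: `μ(g_S, τ) ≥ log 6 − 2 = ν(S⁴)` for every `τ` (RoundBound's VALUE, previously not in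
  the tree), ENT's clause for `S⁴` with `δ = ν(S⁴) − ν_cyl`, and the `S⁴` instance of Statement D.
* `spc4_of_subcylindricalRecognition_of_ricciFatMetric` — D is SPC4-hard (with the rung it gives SPC4).

Everything is proved (no `sorry`, no definition, no named fact); the glue lemmas
`threshold_log_identity`, `threshold_lt_ricciFat_fiftieth` are the planner skeleton's, re-proved here.

References: [BakryGentilLedoux2014] §6; arXiv:1412.5165 eq. (4.1); [CaoHamiltonIlmanen2004] Thm 3.4;
[CarrilloNi2009] §3; [Perelman2002Entropy] §3; [ONeill1983] Ch. 3.
-/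

noncomputable section

-- the registered namespace `Summit.SmoothPoincare4.SmoothPoincare4.Theorems` repeats a component
set_option linter.dupNamespace false

open scoped Manifold ContDiff Topology ENNReal NNReal ContinuousMap
-- Mathlib's scoped instance `Fact (finrank ℝ (EuclideanSpace ℝ (Fin n)) = n)`, feeding the
-- `[Fact (finrank ℝ V = n + 1)]` hypothesis of `roundMetric`
open scoped EuclideanSpace
open Set MeasureTheory
open Literature.Geometry.Lorentzian Literature.Geometry.Riemannian

namespace Summit.SmoothPoincare4.SmoothPoincare4.Theorems

/-! ## EE(3,4) and Theorem A, unconditionally -/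

/-- **The curvature–dimension entropy–energy inequality EE(3,4)** on closed connected Riemannian
4-manifolds with `Ric ≥ 3g`: for every smooth `w` with `∫ w² dV = Vol`,
`(1/Vol) ∫ w² log w² dV ≤ 2 log(1 + ∫ |∇w|² dV/(3 Vol))`. Composite of the landed stubs
B3b ∘ B3a ∘ (B2 ∘ B1) ∘ A of the line (dimensional Bakry–Émery argument along the heat flow).
[cite: BakryGentilLedoux2014, §6] -/
theorem entropyEnergyCD34 :
    ∀ (M : Type) [TopologicalSpace M] [T2Space M] [SecondCountableTopology M]
      [ChartedSpace (EuclideanSpace ℝ (Fin 4)) M] [IsManifold (𝓡 4) ∞ M] [CompactSpace M] [T3Space M]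
      [MeasurableSpace M] [BorelSpace M] [ConnectedSpace M]
      (g : PseudoRiemannianMetric (𝓡 4) ∞ (EuclideanSpace ℝ (Fin 4)) (TangentSpace (𝓡 4) : M → Type _))
      [g.HasLeviCivita] (hg : g.IsRiemannian),
      (∀ (x : M) (v : TangentSpace (𝓡 4) x), 3 * g.val x v v ≤ g.ricci x v v) →
      ∀ w : M → ℝ, ContMDiff (𝓡 4) 𝓘(ℝ, ℝ) ∞ w →
        ∫ x, w x ^ 2 ∂(riemannianMeasure (g.toContMDiffRiemannianMetric hg))
          = (riemannianMeasure (g.toContMDiffRiemannianMetric hg) Set.univ).toReal →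
        (∫ x, w x ^ 2 * Real.log (w x ^ 2) ∂(riemannianMeasure (g.toContMDiffRiemannianMetric hg)))
          / (riemannianMeasure (g.toContMDiffRiemannianMetric hg) Set.univ).toReal ≤
        2 * Real.log (1 + (∫ x, g.gradSq w x ∂(riemannianMeasure (g.toContMDiffRiemannianMetric hg)))
            / (3 * (riemannianMeasure (g.toContMDiffRiemannianMetric hg) Set.univ).toReal)) :=
  stub_entropyEnergy_of_positive
    (stub_entropyEnergy_positive (stub_entropyEnergy_alongFlow stub_dimensionalFisher)
      stub_staticLinearHeat)

/-- **Theorem A (entropy ≥ log-volume under `Ric ≥ 3`)**: on a closed connected Riemannian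
4-manifold with `Ric ≥ 3g`, for every `τ > 0` and every smooth `f` with `∫ (4πτ)⁻² e^{-f} dV = 1`,
`log Vol(M,g) − 2 log(2π/3) − 2 ≤ 𝒲(g,f,τ)`; i.e. `μ(g,τ) ≥ ν(S⁴_rd) + log(Vol/Vol S⁴)` for all `τ`
(`ν(S⁴_rd) = log 6 − 2`, `Vol S⁴ = 8π²/3`), with equality at `τ = 1/6`, `f ≡ 2` for Einstein
metrics `Ric = 3g`. Stub C of the line fed with `entropyEnergyCD34`. [cite: BakryGentilLedoux2014, §6] -/
theorem entropyVolumeComparison :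
    ∀ (M : Type) [TopologicalSpace M] [T2Space M] [SecondCountableTopology M]
      [ChartedSpace (EuclideanSpace ℝ (Fin 4)) M] [IsManifold (𝓡 4) ∞ M] [CompactSpace M] [T3Space M]
      [MeasurableSpace M] [BorelSpace M] [ConnectedSpace M]
      (g : PseudoRiemannianMetric (𝓡 4) ∞ (EuclideanSpace ℝ (Fin 4)) (TangentSpace (𝓡 4) : M → Type _))
      [g.HasLeviCivita] (hg : g.IsRiemannian),
      (∀ (x : M) (v : TangentSpace (𝓡 4) x), 3 * g.val x v v ≤ g.ricci x v v) →
      ∀ τ : ℝ, 0 < τ → ∀ f : M → ℝ, ContMDiff (𝓡 4) 𝓘(ℝ, ℝ) ∞ f →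
        ∫ x, (4 * Real.pi * τ) ^ (-(4 : ℝ) / 2) * Real.exp (-f x)
            ∂(riemannianMeasure (g.toContMDiffRiemannianMetric hg)) = 1 →
        Real.log ((riemannianMeasure (g.toContMDiffRiemannianMetric hg) Set.univ).toReal)
            - 2 * Real.log (2 * Real.pi / 3) - 2 ≤
          ∫ x, (τ * (g.scalarCurvature x + g.gradSq f x) + f x - 4) *
            ((4 * Real.pi * τ) ^ (-(4 : ℝ) / 2) * Real.exp (-f x))
            ∂(riemannianMeasure (g.toContMDiffRiemannianMetric hg)) :=
  stub_entropyVolume_of_entropyEnergy entropyEnergyCD34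

/-- **RoundBound (lower-bound half of `ν(S⁴_round) = log 6 − 2`), without Perelman
monotonicity**: for a closed connected Riemannian 4-manifold with `Ric ≥ 3g` and the volume of the
unit round `S⁴`, `Vol = 8π²/3` (e.g. the round metric, `Ric = 3g`), `μ(g,τ) ≥ log 6 − 2` for EVERY
`τ > 0`: `log(8π²/3) − 2 log(2π/3) − 2 = log 6 − 2` in Theorem A. (The matching upper bound is the
constant test function at `τ = 1/6`, `Negative.constClause_iff`; Cao–Hamilton–Ilmanen 2004, Thm 3.4
give the value via the shrinking sphere.) [cite: CaoHamiltonIlmanen2004, Thm 3.4] -/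
theorem roundBound
    (M : Type) [TopologicalSpace M] [T2Space M] [SecondCountableTopology M]
    [ChartedSpace (EuclideanSpace ℝ (Fin 4)) M] [IsManifold (𝓡 4) ∞ M] [CompactSpace M] [T3Space M]
    [MeasurableSpace M] [BorelSpace M] [ConnectedSpace M]
    (g : PseudoRiemannianMetric (𝓡 4) ∞ (EuclideanSpace ℝ (Fin 4)) (TangentSpace (𝓡 4) : M → Type _))
    [g.HasLeviCivita] (hg : g.IsRiemannian)
    (hRic : ∀ (x : M) (v : TangentSpace (𝓡 4) x), 3 * g.val x v v ≤ g.ricci x v v)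
    (hVol : (riemannianMeasure (g.toContMDiffRiemannianMetric hg) Set.univ).toReal = 8 * Real.pi ^ 2 / 3)
    {τ : ℝ} (hτ : 0 < τ) {f : M → ℝ} (hf : ContMDiff (𝓡 4) 𝓘(ℝ, ℝ) ∞ f)
    (hnorm : ∫ x, (4 * Real.pi * τ) ^ (-(4 : ℝ) / 2) * Real.exp (-f x)
      ∂(riemannianMeasure (g.toContMDiffRiemannianMetric hg)) = 1) :
    Real.log 6 - 2 ≤
      ∫ x, (τ * (g.scalarCurvature x + g.gradSq f x) + f x - 4) *
        ((4 * Real.pi * τ) ^ (-(4 : ℝ) / 2) * Real.exp (-f x))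
        ∂(riemannianMeasure (g.toContMDiffRiemannianMetric hg)) := by
  have hW := entropyVolumeComparison M g hg hRic τ hτ f hf hnorm
  rw [hVol] at hW
  have hπ : 0 < Real.pi := Real.pi_pos
  have h8 : Real.log 8 = 3 * Real.log 2 := by
    rw [show (8 : ℝ) = 2 ^ 3 by norm_num, Real.log_pow]
    push_cast
    ring
  have hB : Real.log (8 * Real.pi ^ 2 / 3) = 3 * Real.log 2 + 2 * Real.log Real.pi - Real.log 3 := by
    rw [Real.log_div (by positivity) (by norm_num), Real.log_mul (by norm_num) (by positivity),
      Real.log_pow, h8]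
    push_cast
    ring
  have h2 : Real.log (2 * Real.pi / 3) = Real.log 2 + Real.log Real.pi - Real.log 3 := by
    rw [Real.log_div (by positivity) (by norm_num), Real.log_mul (by norm_num) hπ.ne']
  have h6 : Real.log 6 = Real.log 2 + Real.log 3 := by
    rw [show (6 : ℝ) = 2 * 3 by norm_num, Real.log_mul (by norm_num) (by norm_num)]
  rw [hB, h2] at hW
  rw [h6]
  linarith

/-! ## Glue numerics -/

/-- **The logarithm of the volume threshold**: `ν_cyl − log((√π e^{1/2}/3)(8π²/3)) = −2 log(2π/3) − 2`,
i.e. with `δ_ENT := log Vol − log T` Theorem A's floor `log Vol − 2 log(2π/3) − 2` is EXACTLY the crux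
level `ν_cyl + δ_ENT`. [folklore] -/
theorem threshold_log_identity :
    (Real.log 2 + Real.log Real.pi / 2 - 3 / 2)
        - Real.log (Real.sqrt Real.pi * Real.exp (1 / 2 : ℝ) / 3 * (8 * Real.pi ^ 2 / 3))
      = -(2 * Real.log (2 * Real.pi / 3)) - 2 := by
  have hπ : 0 < Real.pi := Real.pi_pos
  have hsqrt : 0 < Real.sqrt Real.pi := Real.sqrt_pos.2 hπ
  have hA : Real.log (Real.sqrt Real.pi * Real.exp (1 / 2 : ℝ) / 3)
      = Real.log Real.pi / 2 + 1 / 2 - Real.log 3 := by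
    rw [Real.log_div (by positivity) (by norm_num), Real.log_mul hsqrt.ne' (Real.exp_pos _).ne',
      Real.log_sqrt hπ.le, Real.log_exp]
  have h8 : Real.log 8 = 3 * Real.log 2 := by
    rw [show (8 : ℝ) = 2 ^ 3 by norm_num, Real.log_pow]
    push_cast
    ring
  have hB : Real.log (8 * Real.pi ^ 2 / 3) = 3 * Real.log 2 + 2 * Real.log Real.pi - Real.log 3 := by
    rw [Real.log_div (by positivity) (by norm_num), Real.log_mul (by norm_num) (by positivity),
      Real.log_pow, h8]
    push_cast
    ring
  have h1 : Real.log (Real.sqrt Real.pi * Real.exp (1 / 2 : ℝ) / 3 * (8 * Real.pi ^ 2 / 3))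
      = (Real.log Real.pi / 2 + 1 / 2 - Real.log 3)
        + (3 * Real.log 2 + 2 * Real.log Real.pi - Real.log 3) := by
    rw [Real.log_mul (by positivity) (by positivity), hA, hB]
  have h2 : Real.log (2 * Real.pi / 3) = Real.log 2 + Real.log Real.pi - Real.log 3 := by
    rw [Real.log_div (by positivity) (by norm_num), Real.log_mul (by norm_num) hπ.ne']
  rw [h1, h2]
  ring

/-- **Numerics of the cross-route edge**: `(√π·e^{1/2}/3)·(8π²/3) < (1 − 1/50)·(8π²/3)`, i.e.
`√(πe) < 2.94` (`πe < 3.1416·2.7182818286 < 8.6436 = 2.94²`). [folklore] -/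
theorem threshold_lt_ricciFat_fiftieth :
    Real.sqrt Real.pi * Real.exp (1 / 2 : ℝ) / 3 * (8 * Real.pi ^ 2 / 3)
      < (1 - 1 / 50) * (8 * Real.pi ^ 2 / 3) := by
  have hπ : 0 < Real.pi := Real.pi_pos
  have hsq : (Real.sqrt Real.pi * Real.exp (1 / 2 : ℝ)) ^ 2 = Real.pi * Real.exp 1 := by
    rw [mul_pow, Real.sq_sqrt hπ.le, ← Real.exp_nat_mul]
    norm_num
  have hprod : Real.pi * Real.exp 1 < 2.94 ^ 2 := by
    have h1 := Real.pi_lt_d4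
    have h2 := Real.exp_one_lt_d9
    have h3 := Real.exp_pos (1 : ℝ)
    nlinarith
  have hlt : Real.sqrt Real.pi * Real.exp (1 / 2 : ℝ) < 2.94 := by
    by_contra h
    push Not at h
    have : (2.94 : ℝ) ^ 2 ≤ (Real.sqrt Real.pi * Real.exp (1 / 2 : ℝ)) ^ 2 := by gcongr
    linarith [hsq ▸ this]
  have hV : 0 < 8 * Real.pi ^ 2 / 3 := by positivity
  have h3 : Real.sqrt Real.pi * Real.exp (1 / 2 : ℝ) / 3 < 1 - 1 / 50 := by
    rw [div_lt_iff₀ (by norm_num : (0:ℝ) < 3)]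
    linarith
  exact mul_lt_mul_of_pos_right h3 hV

/-! ## The transfer: ENT from a Ricci-fat metric at the fixed threshold -/

/-- **ENT from Statement D of the line (`RicciFatMetric`, fixed threshold `δ₀ = 1 − √(πe)/3`).**
If every closed smooth `M ≃ₕ S⁴` carries a Riemannian `g` (with Levi-Civita connection) with
`Ric ≥ 3g` and `Vol(M,g) > (√π e^{1/2}/3)(8π²/3)`, then `EntropyRung.SubcylindricalExistence`
(stmt-SmoothPoincare4-10871) holds: `M` is connected (`pathConnectedSpace_of_homotopyEquiv`),
`R ≥ 12 > 0` (`scalarCurvature_ge_four_mul_of_ricci_ge`), and Theorem A bounds every `𝒲(g,f,τ)`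
below by `log Vol − 2 log(2π/3) − 2 = ν_cyl + (log Vol − log T)` (`threshold_log_identity`) with
`δ := log Vol − log T > 0`. This is the line's composition `SubcylindricalExistence_of` with its
six closed stubs discharged; the hypothesis is its only open (SPC4-hard) stub. [folklore] -/
theorem subcylindricalExistence_of_ricciFatMetric :
    (∀ (M : Type) [TopologicalSpace M] [T2Space M] [SecondCountableTopology M]
      [ChartedSpace (EuclideanSpace ℝ (Fin 4)) M] [IsManifold (𝓡 4) ∞ M] [CompactSpace M] [T3Space M]
      [MeasurableSpace M] [BorelSpace M],
      M ≃ₕ Metric.sphere (0 : EuclideanSpace ℝ (Fin 5)) 1 →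
      ∃ g : PseudoRiemannianMetric (𝓡 4) ∞ (EuclideanSpace ℝ (Fin 4)) (TangentSpace (𝓡 4) : M → Type _),
      ∃ _ : g.HasLeviCivita, ∃ hg : g.IsRiemannian,
        (∀ (x : M) (v : TangentSpace (𝓡 4) x), 3 * g.val x v v ≤ g.ricci x v v) ∧
        Real.sqrt Real.pi * Real.exp (1 / 2 : ℝ) / 3 * (8 * Real.pi ^ 2 / 3) <
          (riemannianMeasure (g.toContMDiffRiemannianMetric hg) Set.univ).toReal) →
    Summit.SmoothPoincare4.SmoothPoincare4.Theses.EntropyRung.SubcylindricalExistence := by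
  intro hD M _ _ _ _ _ _ _ _ _ e
  -- `M ≃ₕ S⁴` ⇒ `M` (path) connected: Theorem A carries `[ConnectedSpace M]` (load-bearing)
  haveI : PathConnectedSpace (Metric.sphere (0 : EuclideanSpace ℝ (Fin 5)) 1) :=
    Literature.Topology.FourManifolds.pathConnectedSpace_sphere_four
  haveI : PathConnectedSpace M :=
    Literature.Topology.FourManifolds.pathConnectedSpace_of_homotopyEquiv e
  obtain ⟨g, hLC, hg, hRic, hVol⟩ := hD M e
  set V : ℝ := (riemannianMeasure (g.toContMDiffRiemannianMetric hg) Set.univ).toReal with hVdef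
  set T : ℝ := Real.sqrt Real.pi * Real.exp (1 / 2 : ℝ) / 3 * (8 * Real.pi ^ 2 / 3) with hTdef
  have hTpos : 0 < T := by positivity
  have hVpos : 0 < V := hTpos.trans hVol
  refine ⟨g, hLC, hg, fun x ↦ ?_, Real.log V - Real.log T, sub_pos.2 (Real.log_lt_log hTpos hVol),
    fun τ hτ f hf hnorm ↦ ?_⟩
  · -- `R ≥ 12 > 0`
    have h12 : 4 * (3 : ℝ) ≤ g.scalarCurvature x :=
      EntropyVolume.scalarCurvature_ge_four_mul_of_ricci_ge g hg (c := 3) (hRic x)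
    linarith
  · -- the entropy floor
    have hW := entropyVolumeComparison M g hg hRic τ hτ f hf hnorm
    have hid := threshold_log_identity
    rw [← hTdef] at hid
    linarith

/-- **Cross-route edge: route RicciFat's crux implies ENT.** `RicciFat.RicciFatSphere`
(stmt-SmoothPoincare4-5192: `∀ M ≃ₕ S⁴, ∀ δ > 0, ∃ h, Ric_h ≥ 3h ∧ Vol ≥ (1 − δ)·8π²/3`) at `δ = 1/50`
gives Statement D (`threshold_lt_ricciFat_fiftieth`: `√(πe)/3 < 49/50`; the pseudo-Riemannian metric
of `h` is Riemannian with the same Levi-Civita instance and the same volume measure), hence ENT by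
`subcylindricalExistence_of_ricciFatMetric`. [folklore] -/
theorem subcylindricalExistence_of_ricciFatSphere
    (h : _root_.Summit.SmoothPoincare4.SmoothPoincare4.Theses.RicciFat.RicciFatSphere) :
    _root_.Summit.SmoothPoincare4.SmoothPoincare4.Theses.EntropyRung.SubcylindricalExistence := by
  refine subcylindricalExistence_of_ricciFatMetric fun M _ _ _ _ _ _ _ _ _ e ↦ ?_
  obtain ⟨h₀, hLC, hRic, hVol⟩ := h M e (1 / 50) (by norm_num)
  refine ⟨PseudoRiemannianMetric.ofRiemannian h₀, hLC,
    PseudoRiemannianMetric.isRiemannian_ofRiemannian h₀, fun x v ↦ ?_, ?_⟩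
  · simpa only [PseudoRiemannianMetric.val_ofRiemannian] using hRic x v
  · have hfin : riemannianMeasure h₀ Set.univ ≠ ⊤ :=
      (riemannianVolume_lt_top_of_isCompact_holds h₀ le_rfl isCompact_univ).ne
    have hle : (1 - 1 / 50) * (8 * Real.pi ^ 2 / 3) ≤ (riemannianMeasure h₀ Set.univ).toReal :=
      (ENNReal.ofReal_le_iff_le_toReal hfin).1 hVol
    change _ < (riemannianMeasure h₀ Set.univ).toReal
    exact threshold_lt_ricciFat_fiftieth.trans_le hle

/-! ## The round `S⁴`: RoundBound's value and the `S⁴` instance of Statement D -/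

/-- **The round unit `S⁴` is Einstein with constant `3`**, in the crux's inequality form
`3 g(v,v) ≤ Ric(v,v)` (equality; `ricci_roundMetric_holds` for the Levi-Civita connection
`leviCivita`). [cite: Topping2006, §1.2.1] -/
theorem three_mul_val_le_ricci_roundMetric_four
    [(roundMetric (n := 4) (EuclideanSpace ℝ (Fin 5))).HasLeviCivita]
    (y : Metric.sphere (0 : EuclideanSpace ℝ (Fin 5)) 1) (v : TangentSpace (𝓡 4) y) :
    3 * (roundMetric (n := 4) (EuclideanSpace ℝ (Fin 5))).val y v v ≤
      (roundMetric (n := 4) (EuclideanSpace ℝ (Fin 5))).ricci y v v := by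
  have h := ricci_roundMetric_holds (EuclideanSpace ℝ (Fin 5)) 4
    (roundMetric (n := 4) (EuclideanSpace ℝ (Fin 5))).leviCivita
    (roundMetric (n := 4) (EuclideanSpace ℝ (Fin 5))).isLeviCivita_leviCivita_holds y v v
  rw [PseudoRiemannianMetric.ricci_apply, h]
  norm_num

/-- **RoundBound on the round unit `S⁴` itself: `μ(g_S, τ) ≥ log 6 − 2 = ν(S⁴)` for EVERY
`τ > 0`** — for every smooth `f` on `S⁴ ⊂ ℝ⁵` with `∫ (4πτ)⁻² e^{-f} dV_{g_S} = 1`,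
`log 6 − 2 ≤ 𝒲(g_S, f, τ)` (`Ric = 3 g_S`, `Vol(S⁴) = 8π²/3` by
`toReal_riemannianMeasure_roundMetric_sphere_four_univ`, and `roundBound`). This is the lower-bound
half of the Cao–Hamilton–Ilmanen value `ν(S⁴) = log Θ(S⁴) = log(6/e²)`, obtained WITHOUT Perelman's
monotonicity or the shrinking-sphere flow. [cite: CaoHamiltonIlmanen2004, Thm 3.4] -/
theorem roundSphereFour_wEntropy_ge
    [hLC : (roundMetric (n := 4) (EuclideanSpace ℝ (Fin 5))).HasLeviCivita]
    {τ : ℝ} (hτ : 0 < τ) {f : Metric.sphere (0 : EuclideanSpace ℝ (Fin 5)) 1 → ℝ}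
    (hf : ContMDiff (𝓡 4) 𝓘(ℝ, ℝ) ∞ f)
    (hnorm : ∫ x, (4 * Real.pi * τ) ^ (-(4 : ℝ) / 2) * Real.exp (-f x)
      ∂(riemannianMeasure ((roundMetric (n := 4) (EuclideanSpace ℝ (Fin 5))).toContMDiffRiemannianMetric
        isRiemannian_roundMetric)) = 1) :
    Real.log 6 - 2 ≤
      ∫ x, (τ * ((roundMetric (n := 4) (EuclideanSpace ℝ (Fin 5))).scalarCurvature x
            + (roundMetric (n := 4) (EuclideanSpace ℝ (Fin 5))).gradSq f x) + f x - 4) *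
        ((4 * Real.pi * τ) ^ (-(4 : ℝ) / 2) * Real.exp (-f x))
        ∂(riemannianMeasure ((roundMetric (n := 4) (EuclideanSpace ℝ (Fin 5))).toContMDiffRiemannianMetric
          isRiemannian_roundMetric)) := by
  haveI : PathConnectedSpace (Metric.sphere (0 : EuclideanSpace ℝ (Fin 5)) 1) :=
    Literature.Topology.FourManifolds.pathConnectedSpace_sphere_four
  exact roundBound (Metric.sphere (0 : EuclideanSpace ℝ (Fin 5)) 1)
    (roundMetric (n := 4) (EuclideanSpace ℝ (Fin 5))) isRiemannian_roundMetric
    three_mul_val_le_ricci_roundMetric_four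
    (toReal_riemannianMeasure_roundMetric_sphere_four_univ (EuclideanSpace ℝ (Fin 5))) hτ hf hnorm

/-- **The `S⁴` instance of Statement D** (sanity of the open transfer stub `RicciFatMetric`): the
round metric of the standard `S⁴` has `Ric = 3g` and `Vol = 8π²/3 > (√π e^{1/2}/3)(8π²/3)`
(`√(πe) < 2.94 < 3`), so `M = S⁴` (with any homotopy equivalence) carries a Ricci-fat metric above
the threshold. [folklore] -/
theorem ricciFatMetric_roundSphereFour :
    ∃ g : PseudoRiemannianMetric (𝓡 4) ∞ (EuclideanSpace ℝ (Fin 4))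
        (TangentSpace (𝓡 4) : Metric.sphere (0 : EuclideanSpace ℝ (Fin 5)) 1 → Type _),
      ∃ _ : g.HasLeviCivita, ∃ hg : g.IsRiemannian,
        (∀ (x : Metric.sphere (0 : EuclideanSpace ℝ (Fin 5)) 1) (v : TangentSpace (𝓡 4) x),
          3 * g.val x v v ≤ g.ricci x v v) ∧
        Real.sqrt Real.pi * Real.exp (1 / 2 : ℝ) / 3 * (8 * Real.pi ^ 2 / 3) <
          (riemannianMeasure (g.toContMDiffRiemannianMetric hg) Set.univ).toReal := by
  haveI : (roundMetric (n := 4) (EuclideanSpace ℝ (Fin 5))).HasLeviCivita :=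
    (roundMetric (n := 4) (EuclideanSpace ℝ (Fin 5))).hasLeviCivita
  refine ⟨roundMetric (n := 4) (EuclideanSpace ℝ (Fin 5)), ‹_›, isRiemannian_roundMetric,
    three_mul_val_le_ricci_roundMetric_four, ?_⟩
  rw [toReal_riemannianMeasure_roundMetric_sphere_four_univ (EuclideanSpace ℝ (Fin 5))]
  have hV : 0 < 8 * Real.pi ^ 2 / 3 := by positivity
  calc Real.sqrt Real.pi * Real.exp (1 / 2 : ℝ) / 3 * (8 * Real.pi ^ 2 / 3)
      < (1 - 1 / 50) * (8 * Real.pi ^ 2 / 3) := threshold_lt_ricciFat_fiftieth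
    _ ≤ 8 * Real.pi ^ 2 / 3 := by nlinarith

/-- **ENT's conclusion for the standard `S⁴` with the ROUND metric** (the crux's `S⁴` instance,
certified): `g_S` has `R = 12 > 0` and, with `δ := ν(S⁴) − ν_cyl = (log 6 − 2) − (log 2 + ½ log π − 3/2) > 0`
(`Negative.nuCyl_lt_nuRound`, numerically `0.026 < δ < 0.0263`), `ν_cyl + δ = log 6 − 2 ≤ 𝒲(g_S, f, τ)` for
all `τ > 0` and all normalised smooth `f` (`roundSphereFour_wEntropy_ge`). [folklore] -/
theorem subcylindricalClause_roundSphereFour :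
    ∃ g : PseudoRiemannianMetric (𝓡 4) ∞ (EuclideanSpace ℝ (Fin 4))
        (TangentSpace (𝓡 4) : Metric.sphere (0 : EuclideanSpace ℝ (Fin 5)) 1 → Type _),
      ∃ _ : g.HasLeviCivita, ∃ hg : g.IsRiemannian,
        (∀ x : Metric.sphere (0 : EuclideanSpace ℝ (Fin 5)) 1, 0 < g.scalarCurvature x) ∧
        ∃ δ : ℝ, 0 < δ ∧ ∀ τ : ℝ, 0 < τ → ∀ f : Metric.sphere (0 : EuclideanSpace ℝ (Fin 5)) 1 → ℝ,
          ContMDiff (𝓡 4) 𝓘(ℝ, ℝ) ∞ f →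
          ∫ x, (4 * Real.pi * τ) ^ (-(4 : ℝ) / 2) * Real.exp (-f x)
              ∂(riemannianMeasure (g.toContMDiffRiemannianMetric hg)) = 1 →
            Real.log 2 + Real.log Real.pi / 2 - 3 / 2 + δ ≤
              ∫ x, (τ * (g.scalarCurvature x + g.gradSq f x) + f x - 4) *
                ((4 * Real.pi * τ) ^ (-(4 : ℝ) / 2) * Real.exp (-f x))
                ∂(riemannianMeasure (g.toContMDiffRiemannianMetric hg)) := by
  haveI : (roundMetric (n := 4) (EuclideanSpace ℝ (Fin 5))).HasLeviCivita :=
    (roundMetric (n := 4) (EuclideanSpace ℝ (Fin 5))).hasLeviCivita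
  refine ⟨roundMetric (n := 4) (EuclideanSpace ℝ (Fin 5)), ‹_›, isRiemannian_roundMetric, fun x ↦ ?_,
    (Real.log 6 - 2) - (Real.log 2 + Real.log Real.pi / 2 - 3 / 2),
    sub_pos.2 Summit.SmoothPoincare4.Cruxes.SubcylindricalExistence.Negative.nuCyl_lt_nuRound,
    fun τ hτ f hf hnorm ↦ ?_⟩
  · have h12 : 4 * (3 : ℝ) ≤ (roundMetric (n := 4) (EuclideanSpace ℝ (Fin 5))).scalarCurvature x :=
      EntropyVolume.scalarCurvature_ge_four_mul_of_ricci_ge (roundMetric (n := 4) (EuclideanSpace ℝ (Fin 5)))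
        isRiemannian_roundMetric (c := 3) (three_mul_val_le_ricci_roundMetric_four x)
    linarith
  · have h := roundSphereFour_wEntropy_ge hτ hf hnorm
    linarith

/-- **Statement D is SPC4-hard (the easy direction made explicit)**: together with the rung
`SubcylindricalRecognition` (stmt-SmoothPoincare4-10869), a proof of `RicciFatMetric` proves the
smooth 4-dimensional Poincaré conjecture (`closes` ∘ `subcylindricalExistence_of_ricciFatMetric`).
[folklore] -/
theorem spc4_of_subcylindricalRecognition_of_ricciFatMetric
    (hRung : _root_.Summit.SmoothPoincare4.SmoothPoincare4.Theses.EntropyRung.SubcylindricalRecognition)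
    (hD : ∀ (M : Type) [TopologicalSpace M] [T2Space M] [SecondCountableTopology M]
      [ChartedSpace (EuclideanSpace ℝ (Fin 4)) M] [IsManifold (𝓡 4) ∞ M] [CompactSpace M] [T3Space M]
      [MeasurableSpace M] [BorelSpace M],
      M ≃ₕ Metric.sphere (0 : EuclideanSpace ℝ (Fin 5)) 1 →
      ∃ g : PseudoRiemannianMetric (𝓡 4) ∞ (EuclideanSpace ℝ (Fin 4)) (TangentSpace (𝓡 4) : M → Type _),
      ∃ _ : g.HasLeviCivita, ∃ hg : g.IsRiemannian,
        (∀ (x : M) (v : TangentSpace (𝓡 4) x), 3 * g.val x v v ≤ g.ricci x v v) ∧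
        Real.sqrt Real.pi * Real.exp (1 / 2 : ℝ) / 3 * (8 * Real.pi ^ 2 / 3) <
          (riemannianMeasure (g.toContMDiffRiemannianMetric hg) Set.univ).toReal) :
    _root_.SmoothPoincare4 :=
  _root_.Summit.SmoothPoincare4.SmoothPoincare4.Theses.EntropyRung.closes hRung
    (subcylindricalExistence_of_ricciFatMetric hD)

end Summit.SmoothPoincare4.SmoothPoincare4.Theorems

end
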